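import Summits.Ventures.QEC.Census.CSSNormalFormSAT.EncodeSoundCore
import HarnessLib

/-!
# Semantics of the lex gadget of `NFEnc` (KERNEL-PLAN item 2): `lexClauses` is satisfied by a lexicographically ordered pair

`NFEnc.lexClauses xs ys es` (DIMACS variables `≥ 1`, equal lengths) encodes `xs ≤_lex ys` (most significant first) with equal-prefix
auxiliaries `es`: clauses `[-e_k, -x_k, y_k]` and, while a next position exists, `[-e_k, -x_k, e_{k+1}]`, `[-e_k, y_k, e_{k+1}]`. Proved here:
if under the Boolean assignment `β` (valuation `valOf β`, `EncodeSoundCore.lean`) (H1) `β e_k = true` only when the first `k` bits agree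
(and an ambient prefix proposition `pre` holds), (H2) `pre` implies `lexLE (β xs) (β ys)`, and (H3) `β e_{k+1} = true` whenever `pre` and
the first `k+1` bits agree, then every clause holds (`satisfies_lexClauses`; take `pre := True` and `β e_k := decide (first k bits agree)`
in the final valuation). [folklore]
-/

set_option autoImplicit false

namespace Summit.Ventures.QEC.Census.CSSNormalFormSAT

open NFEnc

/-! ## The lex gadget -/

/-- Lexicographic `≤` on Boolean lists, most significant first (`false < true`). (definition) -/
def lexLE : List Bool → List Bool → Prop
  | [], _ => True
  | _ :: _, [] => False
  | x :: xs, y :: ys => (x = false ∧ y = true) ∨ (x = y ∧ lexLE xs ys)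

/-- The first `k` entries of two Boolean lists agree. (definition) -/
def prefixEq (xs ys : List Bool) (k : ℕ) : Prop := ∀ i, i < k → xs.getD i false = ys.getD i false

/-- **Lex gadget soundness** (with an abstract «earlier prefix agrees» proposition `pre`). Variables `≥ 1`, equal lengths. Hypotheses:
(H1) `β e_k = true → pre ∧ prefixEq k`; (H2) `pre → lexLE`; (H3) `pre ∧ prefixEq (k+1) → β e_{k+1} = true` (for `k + 1 < len`). Then `valOf β`
satisfies every clause of `lexClauses xs ys es`. [folklore] -/
theorem satisfies_lexClauses (β : ℕ → Bool) :
    ∀ (xs ys es : List ℤ) (pre : Prop),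
      (∀ v ∈ xs, 1 ≤ v) → (∀ v ∈ ys, 1 ≤ v) → (∀ v ∈ es, 1 ≤ v) →
      ys.length = xs.length → es.length = xs.length →
      (∀ k, k < es.length → β (es.getD k 0).toNat = true →
          pre ∧ prefixEq (xs.map fun v => β v.toNat) (ys.map fun v => β v.toNat) k) →
      (pre → lexLE (xs.map fun v => β v.toNat) (ys.map fun v => β v.toNat)) →
      (∀ k, k + 1 < es.length →
          pre ∧ prefixEq (xs.map fun v => β v.toNat) (ys.map fun v => β v.toNat) (k + 1) → β (es.getD (k+1) 0).toNat = true) →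
      ∀ cl ∈ lexClauses xs ys es, (valOf β).satisfies (cl.map Sat.Literal.ofInt)
  | [], _, _, _, _, _, _, _, _, _, _, _, cl, hcl => by simp [lexClauses] at hcl
  | _ :: _, [], _, _, _, _, _, h, _, _, _, _, cl, hcl => by simp at h
  | _ :: _, _ :: _, [], _, _, _, _, _, h, _, _, _, cl, hcl => by simp at h
  | x :: xs, y :: ys, e :: es, pre, hx, hy, he, hlen, hlen2, H1, H2, H3, cl, hcl => by
    have hx1 : 1 ≤ x := hx x List.mem_cons_self
    have hy1 : 1 ≤ y := hy y List.mem_cons_self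
    have he1 : 1 ≤ e := he e List.mem_cons_self
    have sat3 : ∀ (l1 l2 l3 : ℤ), l1 ≠ 0 → l2 ≠ 0 → l3 ≠ 0 →
        (litVal β l1 = true ∨ litVal β l2 = true ∨ litVal β l3 = true) →
        (valOf β).satisfies ([l1, l2, l3].map Sat.Literal.ofInt) := by
      intro l1 l2 l3 h1 h2 h3 h
      refine satisfies_of_mem_true β [l1, l2, l3] (by simp [h1, h2, h3]) ?_
      rcases h with h | h | h
      · exact ⟨l1, by simp, h⟩
      · exact ⟨l2, by simp, h⟩
      · exact ⟨l3, by simp, h⟩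
    have lv_pos : ∀ v : ℤ, 1 ≤ v → litVal β v = β v.toNat := by
      intro v hv; simp [litVal, show ¬ v < 0 by omega]
    have lv_neg : ∀ v : ℤ, 1 ≤ v → litVal β (-v) = !β v.toNat := by
      intro v hv
      have h1 : -v < 0 := by omega
      have h2 : (-(-v)).toNat = v.toNat := by omega
      simp only [litVal, h1, if_true, h2]
    -- what (H1)+(H2) give at the head when e is true: x ≤ y as bits, i.e. ¬(x = 1 ∧ y = 0)
    have head : β e.toNat = true → (β x.toNat = true → β y.toNat = true) := by
      intro hβe hβx
      have hl := H2 (H1 0 (by simp) (by simpa using hβe)).1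
      simp only [List.map_cons, lexLE] at hl
      rcases hl with ⟨h1, h2⟩ | ⟨h1, -⟩
      · exact h2
      · rw [← h1]; exact hβx
    unfold lexClauses at hcl
    rcases List.mem_append.1 hcl with h12 | hrest
    rcases List.mem_append.1 h12 with hhere | hlink
    · have hcl' : cl = [-e, -x, y] := by simpa using hhere
      subst hcl'
      apply sat3 _ _ _ (by omega) (by omega) (by omega)
      rw [lv_neg e he1, lv_neg x hx1, lv_pos y hy1]
      cases hβe : β e.toNat <;> cases hβx : β x.toNat <;> simp
      simpa [hβx] using head hβe
    · cases xs with
      | nil => simp at hlink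
      | cons x2 xs2 =>
        cases es with
        | nil => simp at hlink
        | cons e2 es2 =>
          have he2 : 1 ≤ e2 := he e2 (by simp)
          have link : β e.toNat = true → β x.toNat = β y.toNat → β e2.toNat = true := by
            intro hβe hxy
            have hpre := H1 0 (by simp) (by simpa using hβe)
            have h3 := H3 0 (by simp) ⟨hpre.1, ?_⟩
            · simpa using h3
            · intro i hi
              have hi0 : i = 0 := by omega
              subst hi0
              simpa using hxy
          simp only [List.mem_cons, List.not_mem_nil, or_false] at hlink
          rcases hlink with rfl | rfl
          · apply sat3 _ _ _ (by omega) (by omega) (by omega)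
            rw [lv_neg e he1, lv_neg x hx1, lv_pos e2 he2]
            cases hβe : β e.toNat <;> cases hβx : β x.toNat <;> simp
            have hβy : β y.toNat = true := head hβe hβx
            exact link hβe (by rw [hβx, hβy])
          · apply sat3 _ _ _ (by omega) (by omega) (by omega)
            rw [lv_neg e he1, lv_pos y hy1, lv_pos e2 he2]
            cases hβe : β e.toNat <;> cases hβy : β y.toNat <;> simp
            have hβx : β x.toNat = false := by
              cases hβx : β x.toNat
              · rfl
              · exact absurd (head hβe hβx) (by simp [hβy])
            exact link hβe (by rw [hβx, hβy])
    · -- tail clauses: recurse with pre' := pre ∧ head bits agree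
      cases xs with
      | nil => simp [lexClauses] at hrest
      | cons x2 xs2 =>
        cases ys with
        | nil => simp at hlen
        | cons y2 ys2 =>
          cases es with
          | nil => simp at hlen2
          | cons e2 es2 =>
            refine satisfies_lexClauses β (x2 :: xs2) (y2 :: ys2) (e2 :: es2) (pre ∧ β x.toNat = β y.toNat)
              (fun v hv => hx v (List.mem_cons_of_mem _ hv)) (fun v hv => hy v (List.mem_cons_of_mem _ hv))
              (fun v hv => he v (List.mem_cons_of_mem _ hv)) (by simpa using hlen) (by simpa using hlen2) ?_ ?_ ?_ cl hrest
            · intro k hk hβ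
              have h := H1 (k + 1) (by simpa using hk) (by simpa using hβ)
              refine ⟨⟨h.1, ?_⟩, ?_⟩
              · have := h.2 0 (by omega); simpa using this
              · intro i hi; have := h.2 (i + 1) (by omega); simpa using this
            · rintro ⟨hpre, hxy⟩
              have hl := H2 hpre
              simp only [List.map_cons, lexLE] at hl
              rcases hl with ⟨h1, h2⟩ | ⟨-, h2⟩
              · rw [h1, h2] at hxy; simp at hxy
              · exact h2
            · rintro k hk ⟨⟨hpre, hxy⟩, hpf⟩
              have h3 := H3 (k + 1) (by simpa using hk) ⟨hpre, ?_⟩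
              · simpa using h3
              · intro i hi
                rcases i with _ | i
                · simpa using hxy
                · have := hpf i (by omega); simpa using this

end Summit.Ventures.QEC.Census.CSSNormalFormSAT
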